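import Literature.NumberTheory.DiophantineGeometry.GarciaStichtenothPlaces
import HarnessLib

/-!
# The Garcia–Stichtenoth tower: the step `G_{N+1}/G_N` above `x₀ = β`, `β ∈ 𝔽_q`
(Stichtenoth Lemma 7.4.6, [GS96, Lemmas 3.4–3.5])

Topic: `Literature/NumberTheory/DiophantineGeometry` (sub-namespace `GSTower`). Continuation of
`GarciaStichtenothPlaces`: given the profile `Level.BadProfile Q β t α` of a place `Q` of `G_N` above
`x₀ = β` (the orders of all generators and the mirror congruences), we determine the profile of any
place `Q'` of `G_{N+1}` above `Q` (`Level.exists_badProfile_next`), in the three cases of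
[GS96, §3] / the proof of [Stichtenoth 2009, Lemma 7.4.6]:

* **A** (`t = N + 1`: all of `x₀, …, x_N` vanish at `Q`): the step is unramified and `x_{N+1}(Q') ∈ 𝔽_q`;
* **B** (`t ≤ N < 2t`, the "mirror" steps [GS96, Lemma 3.4]): `u(x_N) = z^q - z + O(1)` with
  `z = -α²/x_{2t-N-1}`, the step is unramified and `x_{N+1} ≡ -α²/x_{2t-N-1}`;
* **C** (`2t ≤ N` [GS96, Lemma 3.5 (ii)]): `v_Q(u(x_N)) = -1`, the step is totally ramified with
  `v_{Q'}(x_{N+1}) = -1`.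

Here `𝔽_q ⊆ K` is the hypothesis that every `c` with `c^q = c` in a field over `K` comes from `K`.

## References

* H. Stichtenoth, *Algebraic Function Fields and Codes*, 2nd ed., GTM 254 (2009): Lemma 7.4.6 and
  its proof, Prop. 3.7.8, 3.7.10. [Stichtenoth2009]
* A. Garcia, H. Stichtenoth, J. Number Theory 61 (1996) 248–273: Lemmas 3.4–3.5. [GarciaStichtenoth1996]
-/

noncomputable section

open scoped Classical Polynomial IntermediateField
open Polynomial

namespace Literature.NumberTheory.DiophantineGeometry

open AlgFunctionField

namespace GSTower

namespace Level

variable {K : Type} [Field K] {q : ℕ} [hq : Fact (2 ≤ q)] (L : Level K q)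
variable {p n : ℕ} [Fact p.Prime] [CharP K p]

/-- **Case A of the step: all of `x₀, …, x_N` vanish at `Q`** (`t = N + 1`). Then `G_{N+1}/G_N` is
unramified at `Q'`, `x_{N+1}` is finite with residue in `𝔽_q`: either `x_{N+1} ≡ 0` (`t' = N + 2`) or
`x_{N+1} ≡ α' ∈ 𝔽_q^×` (`t' = N + 1`). [cite: Stichtenoth2009, Lemma 7.4.6 (proof)] -/
theorem exists_badProfile_next_of_t_eq [Finite K] (hqp : q = p ^ n)
    (hFq : ∀ (L' : Type) [Field L'] [Algebra K L'] (c : L'), c ^ q = c → ∃ γ : K, algebraMap K L' γ = c)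
    {Q' : PlaceOver K L.Next} {β : K} {t : ℕ} {α : K}
    (hbad : L.BadProfile (Q'.restrict (K := K) (F := L.carrier)) β t α) (ht : t = L.N + 1) :
    ∃ t' α', L.next.BadProfile Q' β t' α' := by
  have hq2 := hq.out
  have hq0 : (q : ℤ) ≠ 0 := by exact_mod_cast (by omega : q ≠ 0)
  have hexp : L.N - 2 * t = 0 := by omega
  have hordpos : ∀ i ≤ L.N, (Q'.restrict (K := K) (F := L.carrier)).ord (L.x i) = (q : ℤ) ^ i := by
    intro i hi; rw [hbad.ord_lt i (by omega) hi, hexp, pow_zero, one_mul]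
  obtain ⟨hw0, hordw⟩ := ord_u_of_ord_pos (q := q) (Q'.restrict (K := K) (F := L.carrier))
    (z := L.x L.N) (by rw [hordpos L.N le_rfl]; positivity)
  rw [hordpos L.N le_rfl, ← pow_succ'] at hordw
  have hwO : u q (L.x L.N) ∈ (Q'.restrict (K := K) (F := L.carrier)).toValuationSubring := by
    rw [PlaceOver.mem_toValuationSubring_iff_ord_nonneg _ hw0, hordw]; positivity
  obtain ⟨he, hy⟩ := L.unramified_next hqp (z := 0) hwO (by
    rw [zero_pow (by omega), sub_zero, zero_add])
  rw [map_zero, sub_zero] at hy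
  have hrel := L.root_pow_sub_root
  have hordw' : Q'.ord (algebraMap L.carrier L.Next (u q (L.x L.N))) = (q : ℤ) ^ (L.N + 1) := by
    rw [L.ord_algebraMap_of_unramified he, hordw]
  have hw'0 : algebraMap L.carrier L.Next (u q (L.x L.N)) ≠ 0 := (_root_.map_ne_zero _).2 hw0
  -- the residue of `x_{N+1}` lies in `𝔽_q`, hence comes from `K`
  have hres : (IsLocalRing.residue Q'.toValuationSubring ⟨AdjoinRoot.root L.poly, hy⟩) ^ q =
      IsLocalRing.residue Q'.toValuationSubring ⟨AdjoinRoot.root L.poly, hy⟩ := by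
    have hmem : (⟨AdjoinRoot.root L.poly, hy⟩ : Q'.toValuationSubring) ^ q - ⟨AdjoinRoot.root L.poly, hy⟩ ∈
        IsLocalRing.maximalIdeal Q'.toValuationSubring := by
      rw [ValuationSubring.valuation_lt_one_iff]
      change Q'.valuation (AdjoinRoot.root L.poly ^ q - AdjoinRoot.root L.poly) < 1
      rw [hrel, PlaceOver.valuation_lt_one_iff_ord_pos _ hw'0, hordw']; positivity
    rw [← sub_eq_zero, ← map_pow, ← map_sub, IsLocalRing.residue_eq_zero_iff]
    exact hmem
  obtain ⟨γ, hγ⟩ := hFq Q'.residueField _ hres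
  have hγq : γ ^ q = γ := (algebraMap K Q'.residueField).injective (by rw [map_pow, hγ, hres])
  have hγmem : algebraMap K L.Next γ ∈ Q'.toValuationSubring := Q'.algebraMap_mem γ
  have hyγ0 : AdjoinRoot.root L.poly - algebraMap K L.Next γ ≠ 0 := by
    intro h0
    apply hw'0
    rw [← hrel, sub_eq_zero.1 h0, L.algebraMap_next, ← map_pow, ← map_sub, ← map_pow, hγq, sub_self, map_zero]
  have hyγ : 0 < Q'.ord (AdjoinRoot.root L.poly - algebraMap K L.Next γ) := by
    rw [← PlaceOver.valuation_lt_one_iff_ord_pos _ hyγ0]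
    have : IsLocalRing.residue Q'.toValuationSubring ⟨AdjoinRoot.root L.poly, hy⟩ =
        IsLocalRing.residue Q'.toValuationSubring ⟨algebraMap K L.Next γ, hγmem⟩ := by rw [← hγ]; rfl
    exact (PlaceOver.residue_eq_residue_iff _ _ _).1 this
  -- `v(x_{N+1} - γ) = q^{N+1}`
  have hrelγ : (AdjoinRoot.root L.poly - algebraMap K L.Next γ) ^ q -
      (AdjoinRoot.root L.poly - algebraMap K L.Next γ) = algebraMap L.carrier L.Next (u q (L.x L.N)) := by
    rw [sub_pow_q_sub_sub (K := K) hqp, ← map_pow, hγq, sub_self, sub_zero, hrel]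
  obtain ⟨-, hordyγ, -⟩ := inv_add_inv_mem_of_pow_sub_eq Q' hq2 hyγ hrelγ
  rw [hordw'] at hordyγ
  -- transfer of the old generators
  have hold : ∀ i ≤ L.N, Q'.ord (L.next.x i) = (q : ℤ) ^ i := fun i hi => by
    rw [L.next_x_of_le hi, L.ord_algebraMap_of_unramified he, hordpos i hi]
  have hβ : β = 0 := by
    by_contra hβ; have := (hbad.t_eq_zero hβ).1; omega
  by_cases hγ0 : γ = 0
  · refine ⟨L.N + 2, 1, ⟨by rw [L.next_N], fun h => absurd hβ h, fun _ => by omega, one_pow _,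
      one_ne_zero,
      fun i hi hiN => ?_, fun h => ?_, fun i h1 h2 h3 => ?_, fun i h1 h2 h3 => ?_, fun i h1 h2 => ?_⟩⟩
    · rw [L.next_N] at hiN ⊢
      rw [show L.N + 1 - 2 * (L.N + 2) = 0 by omega, pow_zero, one_mul]
      rcases Nat.lt_succ_iff_lt_or_eq.1 (Nat.lt_succ_iff.2 hiN) with hi' | rfl
      · exact hold i (by omega)
      · rw [L.next_x_succ]
        rw [hγ0, map_zero, sub_zero] at hordyγ
        exact hordyγ.symm
    · rw [L.next_N] at h; omega
    · rw [L.next_N] at h3; omega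
    · rw [L.next_N] at h3; omega
    · rw [L.next_N] at h2; omega
  · refine ⟨L.N + 1, γ, ⟨by rw [L.next_N]; omega, fun h => absurd hβ h, fun _ => by omega, hγq, hγ0,
      fun i hi hiN => ?_, fun h => ?_, fun i h1 h2 h3 => ?_, fun i h1 h2 h3 => ?_, fun i h1 h2 => ?_⟩⟩
    · rw [L.next_N] at hiN ⊢
      rw [show L.N + 1 - 2 * (L.N + 1) = 0 by omega, pow_zero, one_mul]
      exact hold i (by omega)
    · rw [L.next_N, show L.N + 1 - 2 * (L.N + 1) = 0 by omega, pow_zero, one_mul, L.next_x_succ]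
      exact hordyγ.symm
    · rw [L.next_N] at h3; omega
    · rw [L.next_N] at h3; omega
    · rw [L.next_N] at h2; omega


omit [Fact p.Prime] [CharP K p] in
/-- Transfer of the mirror congruences to `G_{N+1}`. [folklore] -/
theorem next_x_add_div {Q' : PlaceOver K L.Next} {i k : ℕ} (hi : i ≤ L.N) (hk : k ≤ L.N) {α : K}
    (h : L.x i + algebraMap K L.carrier (α ^ 2) / L.x k ∈
      (Q'.restrict (K := K) (F := L.carrier)).toValuationSubring) :
    L.next.x i + algebraMap K L.next.carrier (α ^ 2) / L.next.x k ∈ Q'.toValuationSubring := by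
  rw [L.next_x_of_le hi, L.next_x_of_le hk, show algebraMap K L.next.carrier (α ^ 2) =
    algebraMap L.carrier L.Next (algebraMap K L.carrier (α ^ 2)) from L.algebraMap_next _,
    ← map_div₀, ← map_add]
  exact (Q'.mem_restrict_iff (K := K) (F := L.carrier) _).1 h

/-- **Case B of the step: the mirror range** `t ≤ N < 2t`. The step is unramified at `Q'` with
`x_{N+1} ≡ -α²/x_{2t-N-1}`. [cite: Stichtenoth2009, Lemma 7.4.6 (proof)] [cite: GarciaStichtenoth1996, Lemma 3.4, (3.4)] -/
theorem badProfile_next_of_lt [Finite K] (hqp : q = p ^ n) {Q' : PlaceOver K L.Next} {β : K} {t : ℕ}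
    {α : K} (hbad : L.BadProfile (Q'.restrict (K := K) (F := L.carrier)) β t α) (htN : t ≤ L.N)
    (h2t : L.N + 1 ≤ 2 * t) : L.next.BadProfile Q' β t α := by
  have hq2 := hq.out
  obtain ⟨w, hw, hu⟩ := L.exists_decomp_u_of_bad hqp hbad htN h2t
  obtain ⟨he, hy⟩ := L.unramified_next hqp hw hu
  set j := 2 * t - L.N - 1 with hj
  have hjN : j < L.N := by omega
  have hjt : j < t := by omega
  have hexp : L.N - 2 * t = 0 := by omega
  have hexp' : L.N + 1 - 2 * t = 0 := by omega
  set z : L.carrier := -(algebraMap K L.carrier (α ^ 2) / L.x j) with hz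
  have hxj : L.x j ≠ 0 := L.x_ne_zero hjN.le
  have ha0 : algebraMap K L.carrier (α ^ 2) ≠ 0 := (_root_.map_ne_zero _).2 (pow_ne_zero _ hbad.ne_zero)
  have hordz : (Q'.restrict (K := K) (F := L.carrier)).ord z = -((q : ℤ) ^ j) := by
    rw [hz, PlaceOver.ord_neg, PlaceOver.ord_div _ ha0 hxj, PlaceOver.ord_algebraMap_holds _
      (pow_ne_zero _ hbad.ne_zero), hbad.ord_lt j hjt hjN.le, hexp, pow_zero, one_mul, zero_sub]
  have hold : ∀ s : L.carrier, Q'.ord (algebraMap L.carrier L.Next s) =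
      (Q'.restrict (K := K) (F := L.carrier)).ord s := L.ord_algebraMap_of_unramified he
  -- `v(x_{N+1}) = v(z) = -q^j`
  have hordy : Q'.ord (AdjoinRoot.root L.poly) = -((q : ℤ) ^ j) := by
    have hz' : Q'.ord (algebraMap L.carrier L.Next z) = -((q : ℤ) ^ j) := by rw [hold, hordz]
    have hz0 : algebraMap L.carrier L.Next z ≠ 0 :=
      Q'.ne_zero_of_ord_ne_zero (by rw [hz']; exact neg_ne_zero.2 (pow_ne_zero _ (by exact_mod_cast (by omega : q ≠ 0))))
    by_cases hy0 : AdjoinRoot.root L.poly - algebraMap L.carrier L.Next z = 0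
    · rw [sub_eq_zero.1 hy0, hz']
    · have hlt : Q'.ord (algebraMap L.carrier L.Next z) <
          Q'.ord (AdjoinRoot.root L.poly - algebraMap L.carrier L.Next z) := by
        rw [hz']; have := Q'.ord_nonneg_of_mem hy
        have : (0 : ℤ) < (q : ℤ) ^ j := by positivity
        omega
      have hst := Q'.ord_add_eq_left_of_lt hz0 hy0 hlt
      rw [add_sub_cancel, hz'] at hst
      exact hst.2
  refine ⟨by rw [L.next_N]; omega, hbad.t_eq_zero, hbad.one_le_t, hbad.pow_eq, hbad.ne_zero,
    fun i hi hiN => ?_, fun h => ?_, fun i h1 h2 h3 => ?_, fun i h1 h2 h3 => ?_, fun i h1 h2 => ?_⟩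
  · rw [L.next_N] at hiN ⊢
    rw [hexp', L.next_x_of_le (by omega), hold, hbad.ord_lt i hi (by omega), hexp]
  · rw [L.next_N] at h ⊢
    rw [hexp', L.next_x_of_le htN, L.algebraMap_next, ← map_sub, hold, hbad.ord_t htN, hexp]
  · rw [L.next_N] at h3 ⊢
    rw [hexp', pow_zero, one_mul]
    rcases Nat.lt_succ_iff_lt_or_eq.1 (Nat.lt_succ_iff.2 h3) with h3' | rfl
    · rw [L.next_x_of_le (by omega), hold, hbad.ord_mid i h1 h2 (by omega), hexp, pow_zero, one_mul]
    · rw [L.next_x_succ, hordy, show 2 * t - (L.N + 1) = j by omega]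
  · rw [L.next_N] at h3
    rcases Nat.lt_succ_iff_lt_or_eq.1 (Nat.lt_succ_iff.2 h3) with h3' | rfl
    · exact L.next_x_add_div (by omega) (by omega) (hbad.mirror i h1 h2 (by omega))
    · rw [L.next_x_succ, L.next_x_of_le (by omega : 2 * t - (L.N + 1) ≤ L.N),
        show 2 * t - (L.N + 1) = j by omega, show algebraMap K L.next.carrier (α ^ 2) =
          algebraMap L.carrier L.Next (algebraMap K L.carrier (α ^ 2)) from L.algebraMap_next _,
        ← map_div₀]
      have : AdjoinRoot.root L.poly + algebraMap L.carrier L.Next (algebraMap K L.carrier (α ^ 2) / L.x j) =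
          AdjoinRoot.root L.poly - algebraMap L.carrier L.Next z := by rw [hz, map_neg, sub_neg_eq_add]
      rw [this]; exact hy
  · rw [L.next_N] at h2; omega

omit [Fact p.Prime] in
/-- **Case C of the step: the ramified range** `2t ≤ N`. The step is totally ramified at `Q'`
(`v_Q(u(x_N)) = -1`) with `v_{Q'}(x_{N+1}) = -1`.
[cite: Stichtenoth2009, Lemma 7.4.6 (proof)] [cite: GarciaStichtenoth1996, Lemma 3.5 (ii)] -/
theorem badProfile_next_of_le (hqp : q = p ^ n) {Q' : PlaceOver K L.Next} {β : K} {t : ℕ}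
    {α : K} (hbad : L.BadProfile (Q'.restrict (K := K) (F := L.carrier)) β t α) (h2t : 2 * t ≤ L.N) :
    L.next.BadProfile Q' β t α := by
  have hq2 := hq.out
  have htN : t ≤ L.N := by omega
  obtain ⟨hordy, he, -, -⟩ := L.ramified_next (L.ord_u_of_bad hqp hbad h2t)
  have hold : ∀ s : L.carrier, Q'.ord (algebraMap L.carrier L.Next s) =
      q * (Q'.restrict (K := K) (F := L.carrier)).ord s := fun s => by
    rw [Q'.ord_algebraMap_eq_mul (K := K) (F := L.carrier) s, he]
  have hexp : L.N + 1 - 2 * t = (L.N - 2 * t) + 1 := by omega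
  refine ⟨by rw [L.next_N]; omega, hbad.t_eq_zero, hbad.one_le_t, hbad.pow_eq, hbad.ne_zero,
    fun i hi hiN => ?_, fun h => ?_, fun i h1 h2 h3 => ?_, fun i h1 h2 h3 => ?_, fun i h1 h2 => ?_⟩
  · rw [L.next_N] at hiN ⊢
    rw [hexp, L.next_x_of_le (by omega), hold, hbad.ord_lt i hi (by omega), pow_succ]; ring
  · rw [L.next_N] at h ⊢
    rw [hexp, L.next_x_of_le htN, L.algebraMap_next, ← map_sub, hold, hbad.ord_t htN, pow_succ]; ring
  · rw [L.next_N] at h3 ⊢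
    rw [hexp, L.next_x_of_le (by omega), hold, hbad.ord_mid i h1 h2 (by omega), pow_succ]; ring
  · rw [L.next_N] at h3
    exact L.next_x_add_div (by omega) (by omega) (hbad.mirror i h1 h2 (by omega))
  · rw [L.next_N] at h2 ⊢
    rcases Nat.lt_succ_iff_lt_or_eq.1 (Nat.lt_succ_iff.2 h2) with h2' | rfl
    · rw [L.next_x_of_le (by omega), hold, hbad.ord_gt i h1 (by omega),
        show L.N + 1 - i = (L.N - i) + 1 by omega, pow_succ]; ring
    · rw [L.next_x_succ, hordy, Nat.sub_self, pow_zero]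

/-- **The step `G_{N+1}/G_N` above `x₀ = β`** (`β ∈ 𝔽_q`, `𝔽_q ⊆ K`): a place `Q'` of `G_{N+1}`
whose restriction has a bad profile has one too. [cite: Stichtenoth2009, Lemma 7.4.6] -/
theorem exists_badProfile_next [Finite K] (hqp : q = p ^ n)
    (hFq : ∀ (L' : Type) [Field L'] [Algebra K L'] (c : L'), c ^ q = c → ∃ γ : K, algebraMap K L' γ = c)
    {Q' : PlaceOver K L.Next} {β : K} {t : ℕ} {α : K}
    (hbad : L.BadProfile (Q'.restrict (K := K) (F := L.carrier)) β t α) :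
    ∃ t' α', L.next.BadProfile Q' β t' α' := by
  rcases Nat.lt_or_ge L.N t with ht | ht
  · exact L.exists_badProfile_next_of_t_eq hqp hFq hbad (le_antisymm hbad.t_le ht)
  · rcases Nat.lt_or_ge L.N (2 * t) with h2 | h2
    · exact ⟨t, α, L.badProfile_next_of_lt hqp hbad ht h2⟩
    · exact ⟨t, α, L.badProfile_next_of_le hqp hbad h2⟩

end Level

end GSTower

end Literature.NumberTheory.DiophantineGeometry
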